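import Mathlib
import Summits.QuantumFields.QCD.Theorems.QuarksAsStableActionUnquenchedChessboardBoundStubMarginalRPBlocks
import HarnessLib

/-!
# The lower block of the antiperiodic Wilson–Dirac matrix under the site reflection (stub
`stub_marginalRP` of crux stmt-QuantumFields-9735, line Sketch — helper file 4)

For an `SU(N)` field `U` on the even four-torus and its antiperiodic lift `apLift U`:

* the reflected antiperiodic field is, up to the `ℤ₂` gauge transformation flipping the slice
  `t = 0`, the antiperiodic lift of the reflected field (`negReflect_apLift`), whence the entrywise
  relation between `D'[apLift (Θ'U)]` and `D'[apLift U]` (`wdc_apLift_negReflect`);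
* the index algebra of the plane flip `π` and of the site reflection `σ` (involutions, commuting,
  `σπ` exchanges the upper class `upIdx` and its complement: `mem_upIdx_sigmaPi_iff`);
* **the lower block is a phase conjugate of the adjoint of the reflected upper block**:
  `D'[apLift U](σπp, σq) = v(p) u(q) conj D'[apLift (Θ'U)](q, πp)` for upper `p, q`
  (`lowerBlock_entry`), with the phases `vPhase, uPhase` equal to `-i` on the plane indices and
  with `∏_{upper} v u = 1` (`prod_upIdx_vPhase_mul_uPhase`).
-/

noncomputable section

open Matrix Complex Finset
open Literature.MathematicalPhysics.QuantumLattice Literature.MathematicalPhysics.QuantumFieldTheory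
open Literature.Probability.LatticeModels
open scoped ComplexConjugate BigOperators

namespace Summit.QuantumFields.QCD.Theorems.UnquenchedChessboardBoundLine

/-! ## The reflected antiperiodic field -/

section Seam

variable {L N : ℕ} [NeZero L]

omit [NeZero L] in
/-- The tree's site reflection `Θ'` (`GaugeConfig.negReflect`) is the shifted link reflection of
`WilsonDiracAP`. -/
theorem negReflect_eq_siteReflect {G : Type*} [Group G] [MeasurableSpace G] (W : GaugeConfig 4 L G) :
    GaugeConfig.negReflect W = (torusConfigShift (Pi.single (0 : Fin 4) (1 : ZMod L)) W).timeReflect := by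
  funext e
  rw [siteReflect_apply']
  rfl

omit [NeZero L] in
/-- **The reflected antiperiodic field**: `Θ'(apLift U)` is the slice flip at `t = 0` of
`apLift (Θ'U)` (the time seam moves from the links leaving `t = -1` to those leaving `t = 0`). -/
theorem negReflect_apLift (U : GaugeConfig 4 L (Matrix.specialUnitaryGroup (Fin N) ℂ)) :
    GaugeConfig.negReflect (apLift U) =
      gaugeTransform (sliceSign 0 0) (apLift (GaugeConfig.negReflect U)) := by
  rw [negReflect_eq_siteReflect, negReflect_eq_siteReflect, apLift_eq_apTwistAt, apLift_eq_apTwistAt,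
    apTwistAt_torusConfigShift, apTwistAt_timeReflect, ← unitaryLift_torusConfigShift,
    ← unitaryLift_timeReflect]
  have hc : ∀ s : Fin 4 → ZMod L, s = (fun _ => (-1 : ZMod L)) + Pi.single (0 : Fin 4) (1 : ZMod L) →
      Function.update s 0 (-s 0) =
        Function.update (fun _ : Fin 4 => (-1 : ZMod L)) 0 ((fun _ : Fin 4 => (-1 : ZMod L)) 0 + 1) := by
    rintro s rfl
    funext k
    by_cases hk : k = 0
    · subst hk; simp
    · simp [hk]
  rw [hc _ rfl, apTwistAt_update_succ]
  congr 2
  exact neg_add_cancel 1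

/-- The sign of the slice flip at `t = 0`, as a complex number. -/
def timeSign (x : TorusSite 4 L) : ℂ := if x 0 = 0 then -1 else 1

omit [NeZero L] in
/-- `timeSign² = 1`. -/
theorem timeSign_mul_self (x : TorusSite 4 L) : timeSign x * timeSign x = 1 := by
  unfold timeSign; split_ifs <;> norm_num

omit [NeZero L] in
/-- `timeSign` is real. -/
theorem conj_timeSign (x : TorusSite 4 L) : conj (timeSign x) = timeSign x := by
  unfold timeSign; split_ifs <;> simp

omit [NeZero L] in
/-- `timeSign` only depends on the time. -/
theorem timeSign_siteTimeNeg (x : TorusSite 4 L) : timeSign (siteTimeNeg x) = timeSign x := by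
  unfold timeSign; simp only [siteTimeNeg_apply_zero, neg_eq_zero]

omit [NeZero L] in
/-- **The chiral antiperiodic matrix of the reflected field** in terms of that of the field:
seam sign, reflection phases and the index map `(x, a, α) ↦ (-x₀, a, flip α)`. -/
theorem wdc_apLift_negReflect (U : GaugeConfig 4 L (Matrix.specialUnitaryGroup (Fin N) ℂ)) (m : ℝ)
    (p q : TorusSite 4 L × Fin N × Fin 4) :
    wilsonDiracG (unitaryFundamentalRep (Fin N) ℂ) chiralGamma (apLift (GaugeConfig.negReflect U)) m 1 p q =
      timeSign p.1 * timeSign q.1 * (chi p.2.2 * conj (chi q.2.2) *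
        wilsonDiracG (unitaryFundamentalRep (Fin N) ℂ) chiralGamma (apLift U) m 1
          (chiralReflectIndex siteTimeNeg p) (chiralReflectIndex siteTimeNeg q)) := by
  have hrefl := wilsonDiracG_chiral_reflect (unitaryFundamentalRep (Fin N) ℂ) siteTimeNeg
    siteTimeNeg_involutive siteTimeNeg_eq_shift_iff (fun x k hk => siteTimeNeg_shift_of_ne x hk)
    (apLift U) (GaugeConfig.negReflect (apLift U)) (fun x => by simp [GaugeConfig.negReflect]; rfl)
    (fun x k hk => by simp [GaugeConfig.negReflect, hk]; rfl) m 1 p q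
  have hgauge := wilsonDiracG_gaugeTransform_central (unitaryFundamentalRep (Fin N) ℂ) chiralGamma
    (sliceSign 0 0) timeSign (fun x => by
      unfold sliceSign timeSign
      split_ifs
      · rw [unitaryFundamentalRep_apply, Unitary.coe_neg]; simp
      · rw [map_one, one_smul]) timeSign_mul_self
    (apLift (GaugeConfig.negReflect U)) m 1 p q
  rw [← negReflect_apLift, hrefl] at hgauge
  calc _ = timeSign p.1 * timeSign q.1 * (timeSign p.1 * timeSign q.1 *
        wilsonDiracG (unitaryFundamentalRep (Fin N) ℂ) chiralGamma (apLift (GaugeConfig.negReflect U))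
          m 1 p q) := by
        rw [← mul_assoc, show timeSign p.1 * timeSign q.1 * (timeSign p.1 * timeSign q.1) =
          (timeSign p.1 * timeSign p.1) * (timeSign q.1 * timeSign q.1) by ring, timeSign_mul_self,
          timeSign_mul_self, one_mul, one_mul]
    _ = _ := by rw [← hgauge]

end Seam

/-! ## Index algebra of `π` and `σ` -/

section IndexAlgebra

variable {L N : ℕ} [NeZero L] [Fact (1 < L)]

omit [Fact (1 < L)] in
/-- `π` does not move the site. -/
@[simp] theorem piMap_fst (p : TorusSite 4 L × Fin N × Fin 4) : (piMap p).1 = p.1 := by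
  unfold piMap flipSpin; split_ifs <;> rfl

omit [Fact (1 < L)] in
/-- `π` does not move the colour. -/
@[simp] theorem piMap_snd_fst (p : TorusSite 4 L × Fin N × Fin 4) : (piMap p).2.1 = p.2.1 := by
  unfold piMap flipSpin; split_ifs <;> rfl

omit [Fact (1 < L)] in
/-- `π` is an involution. -/
theorem piMap_piMap (p : TorusSite 4 L × Fin N × Fin 4) : piMap (piMap p) = p := by
  by_cases h : p ∈ planeIdx
  · have h' : flipSpin p ∈ planeIdx := by rw [mem_planeIdx] at h ⊢; exact h
    rw [piMap_of_mem h, piMap_of_mem h']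
    simp [flipSpin, sflip_sflip]
  · rw [piMap_of_not_mem h, piMap_of_not_mem h]

/-- `σ` preserves the planes (even `L`). -/
theorem sigmaMap_mem_planeIdx_iff (hL : Even L) (p : TorusSite 4 L × Fin N × Fin 4) :
    sigmaMap p ∈ planeIdx ↔ p ∈ planeIdx := by
  rw [mem_planeIdx, mem_planeIdx, tv_sigmaMap]
  have := tv_lt p.1
  have h1 : 1 < L := Fact.out
  have hL' := Nat.even_iff.1 hL
  split_ifs <;> omega

/-- `π` and `σ` commute. -/
theorem piMap_sigmaMap (hL : Even L) (p : TorusSite 4 L × Fin N × Fin 4) :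
    piMap (sigmaMap p) = sigmaMap (piMap p) := by
  by_cases h : p ∈ planeIdx
  · rw [piMap_of_mem h, piMap_of_mem ((sigmaMap_mem_planeIdx_iff hL p).2 h)]; rfl
  · rw [piMap_of_not_mem h, piMap_of_not_mem (fun h' => h ((sigmaMap_mem_planeIdx_iff hL p).1 h'))]

omit [NeZero L] [Fact (1 < L)] in
/-- `σ` is an involution. -/
theorem sigmaMap_sigmaMap (p : TorusSite 4 L × Fin N × Fin 4) : sigmaMap (sigmaMap p) = p := by
  unfold sigmaMap
  simp only [siteTimeNeg_involutive p.1]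

/-- `σπ` is an involution. -/
theorem sigmaPi_sigmaPi (hL : Even L) (p : TorusSite 4 L × Fin N × Fin 4) :
    sigmaMap (piMap (sigmaMap (piMap p))) = p := by
  rw [piMap_sigmaMap hL, sigmaMap_sigmaMap, piMap_piMap]

/-- `σπ` exchanges the upper class and its complement (`L` even, `L ≥ 4`). -/
theorem mem_upIdx_sigmaPi_iff (hL : Even L) (h4 : 4 ≤ L) (p : TorusSite 4 L × Fin N × Fin 4) :
    sigmaMap (piMap p) ∈ upIdx ↔ p ∉ upIdx := by
  have hL' := Nat.even_iff.1 hL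
  have hpl := tv_lt p.1
  rw [mem_upIdx, mem_upIdx, ← piMap_sigmaMap hL]
  by_cases h : sigmaMap p ∈ planeIdx
  · rw [piMap_of_mem h]
    rw [mem_planeIdx, tv_sigmaMap] at h
    simp only [flipSpin, sigmaMap, sflip_val, tv_siteTimeNeg]
    split_ifs at h ⊢ <;> omega
  · rw [piMap_of_not_mem h]
    rw [mem_planeIdx, tv_sigmaMap] at h
    simp only [sigmaMap, tv_siteTimeNeg]
    split_ifs at h ⊢ <;> omega

end IndexAlgebra

/-! ## The lower block -/

section Lower

variable {L N : ℕ} [NeZero L] [Fact (1 < L)]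

/-- The row phases of the lower block. -/
def vPhase (p : TorusSite 4 L × Fin N × Fin 4) : ℂ := timeSign p.1 * conj (chi (piMap p).2.2)

/-- The column phases of the lower block. -/
def uPhase (p : TorusSite 4 L × Fin N × Fin 4) : ℂ := timeSign p.1 * chi p.2.2

omit [Fact (1 < L)] in
/-- On plane upper indices `u = -i`. -/
theorem uPhase_of_mem {p : TorusSite 4 L × Fin N × Fin 4} (hp : p ∈ upIdx) (hpl : p ∈ planeIdx) (hL : Even L)
    (h4 : 4 ≤ L) : uPhase p = -I := by
  have hL' := Nat.even_iff.1 hL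
  rw [mem_upIdx] at hp; rw [mem_planeIdx] at hpl
  obtain ⟨x, a, α⟩ := p
  simp only at hp hpl
  unfold uPhase timeSign
  have h0 : x 0 = 0 ↔ tv x = 0 := (ZMod.val_eq_zero (x 0)).symm
  simp only [h0]
  rcases hpl with h | h
  · rw [if_pos h]
    have hα : 2 ≤ α.val := by omega
    fin_cases α <;> simp_all [chi]
  · rw [if_neg (by omega)]
    have hα : α.val < 2 := by omega
    fin_cases α <;> simp_all [chi]

omit [Fact (1 < L)] in
/-- On plane upper indices `v = -i`. -/
theorem vPhase_of_mem {p : TorusSite 4 L × Fin N × Fin 4} (hp : p ∈ upIdx) (hpl : p ∈ planeIdx) (hL : Even L)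
    (h4 : 4 ≤ L) : vPhase p = -I := by
  have hL' := Nat.even_iff.1 hL
  unfold vPhase
  rw [piMap_of_mem hpl]
  rw [mem_upIdx] at hp; rw [mem_planeIdx] at hpl
  obtain ⟨x, a, α⟩ := p
  simp only at hp hpl
  unfold timeSign
  have h0 : x 0 = 0 ↔ tv x = 0 := (ZMod.val_eq_zero (x 0)).symm
  simp only [h0, flipSpin]
  rcases hpl with h | h
  · rw [if_pos h]
    have hα : 2 ≤ α.val := by omega
    fin_cases α <;> simp_all [chi, sflip]
  · rw [if_neg (by omega)]
    have hα : α.val < 2 := by omega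
    fin_cases α <;> simp_all [chi, sflip]

omit [Fact (1 < L)] in
/-- Off the planes `v u = 1`. -/
theorem vPhase_mul_uPhase_of_not_mem {p : TorusSite 4 L × Fin N × Fin 4} (hpl : p ∉ planeIdx) :
    vPhase p * uPhase p = 1 := by
  unfold vPhase uPhase
  rw [piMap_of_not_mem hpl]
  calc timeSign p.1 * conj (chi p.2.2) * (timeSign p.1 * chi p.2.2)
      = (timeSign p.1 * timeSign p.1) * (chi p.2.2 * conj (chi p.2.2)) := by ring
    _ = 1 := by rw [timeSign_mul_self, chi_mul_conj, one_mul]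

/-- The spin-pairing involution `0 ↔ 1`, `2 ↔ 3` (same chirality, other component). -/
def spinPair : Fin 4 → Fin 4 := ![1, 0, 3, 2]

/-- `spinPair` is a fixed-point-free involution preserving the chirality. -/
theorem spinPair_props (α : Fin 4) :
    spinPair (spinPair α) = α ∧ spinPair α ≠ α ∧ ((spinPair α).val < 2 ↔ α.val < 2) := by
  fin_cases α <;> simp [spinPair]

omit [Fact (1 < L)] in
/-- **`∏_{upper} v u = 1`**: the plane indices pair off under `spinPair` (each pair contributes
`(-i)²·(-i)² = 1`), the interior indices contribute `1` each. -/
theorem prod_upIdx_vPhase_mul_uPhase (hL : Even L) (h4 : 4 ≤ L) :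
    ∏ p ∈ (upIdx : Finset (TorusSite 4 L × Fin N × Fin 4)), vPhase p * uPhase p = 1 := by
  refine Finset.prod_involution (fun p _ => (p.1, p.2.1, spinPair p.2.2)) ?_ ?_ ?_ ?_
  · intro p hp
    by_cases hpl : p ∈ planeIdx
    · have hpl' : ((p.1, p.2.1, spinPair p.2.2) : TorusSite 4 L × Fin N × Fin 4) ∈ planeIdx := by
        rw [mem_planeIdx] at hpl ⊢; exact hpl
      have hp' : ((p.1, p.2.1, spinPair p.2.2) : TorusSite 4 L × Fin N × Fin 4) ∈ upIdx := by
        rw [mem_upIdx] at hp ⊢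
        have := (spinPair_props p.2.2).2.2
        simp only at hp ⊢
        omega
      rw [vPhase_of_mem hp hpl hL h4, uPhase_of_mem hp hpl hL h4, vPhase_of_mem hp' hpl' hL h4,
        uPhase_of_mem hp' hpl' hL h4]
      simp
    · have hpl' : ((p.1, p.2.1, spinPair p.2.2) : TorusSite 4 L × Fin N × Fin 4) ∉ planeIdx := by
        rw [mem_planeIdx] at hpl ⊢; exact hpl
      rw [vPhase_mul_uPhase_of_not_mem hpl, vPhase_mul_uPhase_of_not_mem hpl', one_mul]
  · intro p _ _ h
    exact (spinPair_props p.2.2).2.1 (congrArg (fun q : TorusSite 4 L × Fin N × Fin 4 => q.2.2) h)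
  · intro p hp
    rw [mem_upIdx] at hp ⊢
    have := (spinPair_props p.2.2).2.2
    simp only at hp ⊢
    omega
  · intro p _
    simp [(spinPair_props p.2.2).1]

end Lower

/-! ## The lower block identity -/

/-- **The lower block**: for upper `p, q`,
`D'[apLift U](σπp, σq) = v(p) u(q) · conj D'[apLift (Θ'U)](q, πp)`. -/
theorem lowerBlock_entry {L N : ℕ} [NeZero L] (U : GaugeConfig 4 L (Matrix.specialUnitaryGroup (Fin N) ℂ))
    (m : ℝ) (p q : TorusSite 4 L × Fin N × Fin 4) :
    wilsonDiracG (unitaryFundamentalRep (Fin N) ℂ) chiralGamma (apLift U) m 1 (sigmaMap (piMap p)) (sigmaMap q) =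
      vPhase p * uPhase q * conj (wilsonDiracG (unitaryFundamentalRep (Fin N) ℂ) chiralGamma
        (apLift (GaugeConfig.negReflect U)) m 1 q (piMap p)) := by
  have hconj := wilsonDiracG_chiral_conj (unitaryFundamentalRep (Fin N) ℂ) unitaryFundamentalRep_mem_unitaryGroup
    (apLift U) m 1 (chiralReflectIndex siteTimeNeg (piMap p)) (chiralReflectIndex siteTimeNeg q)
  have h1 : ((chiralReflectIndex siteTimeNeg (piMap p)).1, (chiralReflectIndex siteTimeNeg (piMap p)).2.1,
      sflip (chiralReflectIndex siteTimeNeg (piMap p)).2.2) = sigmaMap (piMap (L := L) (N := N) p) := by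
    simp [chiralReflectIndex, sigmaMap, sflip_sflip]
  have h2 : ((chiralReflectIndex siteTimeNeg q).1, (chiralReflectIndex siteTimeNeg q).2.1,
      sflip (chiralReflectIndex siteTimeNeg q).2.2) = sigmaMap (L := L) (N := N) q := by
    simp [chiralReflectIndex, sigmaMap, sflip_sflip]
  rw [h1, h2] at hconj
  rw [← hconj, wdc_apLift_negReflect, map_mul, map_mul, map_mul, map_mul, Complex.conj_conj,
    conj_timeSign, conj_timeSign, piMap_fst, vPhase, uPhase]
  have hq := chi_mul_conj q.2.2
  have hp' := chi_mul_conj (piMap p).2.2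
  set z := conj (wilsonDiracG (unitaryFundamentalRep (Fin N) ℂ) chiralGamma (apLift U) m 1
    (chiralReflectIndex siteTimeNeg q) (chiralReflectIndex siteTimeNeg (piMap p)))
  symm
  calc timeSign p.1 * conj (chi (piMap p).2.2) * (timeSign q.1 * chi q.2.2) *
        (timeSign q.1 * timeSign p.1 * (conj (chi q.2.2) * chi (piMap p).2.2 * z))
      = (timeSign p.1 * timeSign p.1) * (timeSign q.1 * timeSign q.1) * (chi q.2.2 * conj (chi q.2.2)) *
          (chi (piMap p).2.2 * conj (chi (piMap p).2.2)) * z := by ring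
    _ = z := by rw [timeSign_mul_self, timeSign_mul_self, hq, hp', one_mul, one_mul, one_mul, one_mul]


end Summit.QuantumFields.QCD.Theorems.UnquenchedChessboardBoundLine

end
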